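import Mathlib
import HarnessLib
import Summits.HubbardSuperconductivity.HubbardSuperconductivity.Theorems.ComplexGFFStiffnessHypACumulantHolomorphicFamilies
import Summits.HubbardSuperconductivity.HubbardSuperconductivity.Theorems.ComplexGFFStiffnessHypACumulantHolomorphicLimits

/-!
# Crux `HypACumulant`, line `gnv` — holomorphic Taylor coefficients from POINTWISE holomorphy, per-parameter
# smoothness and LOCALLY BOUNDED jets (no joint smoothness)

Route `route-HubbardSuperconductivity-ComplexGFFStiffness`, cruxes stmt-HubbardSuperconductivity-19154 /
-19155, shared research statement `OnePointLipschitz`, census (C3d′) (memo §8).  The decisive form of (H1)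
for the renormalisation maps: a family `F : ℂ → E → ℂ` such that

* `σ ↦ F σ u` is holomorphic on the open set `U` for every field `u` (pointwise holomorphy — immediate for
  products of exponentials of affine Hamiltonians and affine activities, and for their fluctuation integrals
  by dominated holomorphy `…HolomorphicIntegral`),
* `F σ` is `C^n` in the field for each `σ ∈ U` (the tree: `FluctuationSmooth`, `RenormalisationMapSummandsSmooth`),
* the jets are LOCALLY BOUNDED: `‖D^s F_σ(u)‖ ≤ B` for `σ` near `σ₀`, `u` near `u₀`, `s ≤ n` (the tree's
  UNIFORM weighted norm bounds `TayNormLE … C` of Theorem 6.8 on the complex `(H,K)`-ball),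

has holomorphic Taylor coefficients `σ ↦ D^s F_σ(u)(v)` on `U` for all `s ≤ n`
(**`differentiableOn_iteratedFDeriv_apply_of_pointwise`**).  Induction on `s`: the next coefficient is a
line derivative, i.e. a pointwise limit of difference quotients of the previous ones — holomorphic by
induction — which are locally bounded by the mean value inequality; pointwise limits of locally bounded
holomorphic sequences are holomorphic (`…HolomorphicLimits`).  This class is trivially closed under
products (`ContDiff.mul`, `norm_iteratedFDeriv_mul_le`) and under the fluctuation integral (Lemma 8.4,
`ℓ = 0`), which is what the structural pass over `T_k` needs.  Pure analysis; all proved, no `sorry`.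

## References
* S. Adams, S. Buchholz, R. Kotecký, S. Müller, arXiv:1910.13564, Ch. 10–11, Lemma 8.4
  [AdamsBuchholzKoteckyMuller2019].
-/

noncomputable section

-- `Summit.<Summit>.<Problem>`: single-conjunct summit, the duplicate component is mandated (D-0017).
set_option linter.dupNamespace false

namespace Summit.HubbardSuperconductivity.HubbardSuperconductivity.Theorems.ComplexGFF

open Metric Set Filter Topology

variable {E : Type*} [NormedAddCommGroup E] [NormedSpace ℝ E]

/-- **Holomorphic Taylor coefficients from pointwise holomorphy, per-parameter smoothness and locally
bounded jets.** -/
theorem differentiableOn_iteratedFDeriv_apply_of_pointwise {U : Set ℂ} (hU : IsOpen U) {F : ℂ → E → ℂ} {n : ℕ}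
    (hhol : ∀ u : E, DifferentiableOn ℂ (fun σ => F σ u) U)
    (hsmooth : ∀ σ ∈ U, ContDiff ℝ (n : WithTop ℕ∞) (F σ))
    (hbd : ∀ s : ℕ, s ≤ n → ∀ σ₀ ∈ U, ∀ u₀ : E, ∃ r > 0, ∃ ρ > 0, ∃ B : ℝ, closedBall σ₀ r ⊆ U ∧
      ∀ σ ∈ closedBall σ₀ r, ∀ u ∈ ball u₀ ρ, ‖iteratedFDeriv ℝ s (F σ) u‖ ≤ B)
    (s : ℕ) (hs : s ≤ n) :
    ∀ (u : E) (v : Fin s → E), DifferentiableOn ℂ (fun σ => iteratedFDeriv ℝ s (F σ) u v) U := by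
  induction s with
  | zero =>
    intro u v
    have e : ∀ σ, iteratedFDeriv ℝ 0 (F σ) u v = F σ u := fun σ => iteratedFDeriv_zero_apply v
    simp only [e]
    exact hhol u
  | succ s ih =>
    intro u v
    have hs' : s ≤ n := Nat.le_of_succ_le hs
    have ihs := ih hs'
    -- the previous coefficient as a function of the field
    set g : ℂ → E → ℂ := fun σ y => iteratedFDeriv ℝ s (F σ) y (Fin.tail v) with hg
    -- key identity and the line derivative, for `σ ∈ U`
    have hkey : ∀ σ ∈ U, ∀ y : E, iteratedFDeriv ℝ (s + 1) (F σ) y v = fderiv ℝ (g σ) y (v 0) := by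
      intro σ hσ y
      rw [iteratedFDeriv_succ_apply_left]
      have hlt : (s : WithTop ℕ∞) < (n : WithTop ℕ∞) := by exact_mod_cast (Nat.lt_of_succ_le hs)
      have hd : DifferentiableAt ℝ (iteratedFDeriv ℝ s (F σ)) y := ((hsmooth σ hσ).differentiable_iteratedFDeriv hlt) y
      have hcomp : fderiv ℝ (g σ) y =
          (ContinuousMultilinearMap.apply ℝ (fun _ : Fin s => E) ℂ (Fin.tail v)).comp (fderiv ℝ (iteratedFDeriv ℝ s (F σ)) y) := by
        have h := ((ContinuousMultilinearMap.apply ℝ (fun _ : Fin s => E) ℂ (Fin.tail v)).hasFDerivAt.comp y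
          hd.hasFDerivAt).fderiv
        simpa [hg, Function.comp_def] using h
      rw [hcomp]
      rfl
    have hgdiff : ∀ σ ∈ U, ∀ y : E, DifferentiableAt ℝ (g σ) y := by
      intro σ hσ y
      have hlt : (s : WithTop ℕ∞) < (n : WithTop ℕ∞) := by exact_mod_cast (Nat.lt_of_succ_le hs)
      have hd : DifferentiableAt ℝ (iteratedFDeriv ℝ s (F σ)) y := ((hsmooth σ hσ).differentiable_iteratedFDeriv hlt) y
      exact (ContinuousMultilinearMap.apply ℝ (fun _ : Fin s => E) ℂ (Fin.tail v)).differentiableAt.comp y hd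
    -- the line function and its derivative
    have hline : ∀ σ ∈ U, ∀ t : ℝ, HasDerivAt (fun t' : ℝ => g σ (u + t' • v 0))
        (iteratedFDeriv ℝ (s + 1) (F σ) (u + t • v 0) v) t := by
      intro σ hσ t
      have hl : HasDerivAt (fun t' : ℝ => u + t' • v 0) (v 0) t := by
        have := ((hasDerivAt_id t).smul_const (v 0)).const_add u
        simpa using this
      have h := (hgdiff σ hσ (u + t • v 0)).hasFDerivAt.comp_hasDerivAt t hl
      rw [hkey σ hσ]
      exact h
    -- the difference quotients
    set hseq : ℕ → ℝ := fun k => 1 / ((k : ℝ) + 1) with hhseq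
    have hpos : ∀ k, 0 < hseq k := fun k => by positivity
    set q : ℕ → ℂ → ℂ := fun k σ => ((hseq k : ℝ) : ℂ)⁻¹ * (g σ (u + hseq k • v 0) - g σ u) with hq
    -- (a) holomorphy of the quotients
    have hqhol : ∀ k, DifferentiableOn ℂ (q k) U := fun k =>
      ((ihs (u + hseq k • v 0) (Fin.tail v)).sub (ihs u (Fin.tail v))).const_mul _
    -- (c) pointwise convergence on `U`
    have hqlim : ∀ σ ∈ U, Tendsto (fun k => q k σ) atTop (𝓝 (iteratedFDeriv ℝ (s + 1) (F σ) u v)) := by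
      intro σ hσ
      have h0 := (hline σ hσ 0).tendsto_slope_zero
      simp only [zero_smul, add_zero, zero_add] at h0
      have htend : Tendsto hseq atTop (𝓝[≠] 0) := by
        refine tendsto_nhdsWithin_of_tendsto_nhds_of_eventually_within _ ?_ (Eventually.of_forall fun k => (hpos k).ne')
        exact tendsto_one_div_add_atTop_nhds_zero_nat
      have h1 := h0.comp htend
      refine h1.congr (fun k => ?_)
      simp only [hq, Function.comp_apply, Complex.real_smul, Complex.ofReal_inv]
    -- (b) local boundedness of the quotients
    have hqbd : ∀ σ₀ ∈ U, ∃ r > 0, ∃ M : ℝ, closedBall σ₀ r ⊆ U ∧ ∀ᶠ k in atTop, ∀ σ ∈ closedBall σ₀ r, ‖q k σ‖ ≤ M := by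
      intro σ₀ hσ₀
      obtain ⟨r, hr, ρ, hρ, B, hsub, hB⟩ := hbd (s + 1) hs σ₀ hσ₀ u
      refine ⟨r, hr, B * ‖v 0‖ * ∏ i, ‖Fin.tail v i‖, hsub, ?_⟩
      have hev : ∀ᶠ k : ℕ in atTop, hseq k * ‖v 0‖ < ρ := by
        have ht : Tendsto (fun k => hseq k * ‖v 0‖) atTop (𝓝 (0 * ‖v 0‖)) :=
          tendsto_one_div_add_atTop_nhds_zero_nat.mul_const _
        rw [zero_mul] at ht
        exact ht (gt_mem_nhds hρ)
      filter_upwards [hev] with k hk σ hσ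
      have hσU : σ ∈ U := hsub hσ
      have hB0 : 0 ≤ B := le_trans (norm_nonneg _) (hB σ hσ u (mem_ball_self hρ))
      -- mean value inequality on `[0, h_k]`
      set Mv : ℝ := B * ‖v 0‖ * ∏ i, ‖Fin.tail v i‖ with hMv
      have hderivbd : ∀ t ∈ Ico (0 : ℝ) (hseq k), ‖iteratedFDeriv ℝ (s + 1) (F σ) (u + t • v 0) v‖ ≤ Mv := by
        intro t ht
        have hmem : u + t • v 0 ∈ ball u ρ := by
          rw [mem_ball, dist_eq_norm, add_sub_cancel_left, norm_smul, Real.norm_eq_abs, abs_of_nonneg ht.1]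
          exact lt_of_le_of_lt (mul_le_mul_of_nonneg_right ht.2.le (norm_nonneg _)) hk
        calc ‖iteratedFDeriv ℝ (s + 1) (F σ) (u + t • v 0) v‖
            ≤ ‖iteratedFDeriv ℝ (s + 1) (F σ) (u + t • v 0)‖ * ∏ i, ‖v i‖ := ContinuousMultilinearMap.le_opNorm _ _
          _ ≤ B * ∏ i, ‖v i‖ := mul_le_mul_of_nonneg_right (hB σ hσ _ hmem) (Finset.prod_nonneg fun i _ => norm_nonneg _)
          _ = Mv := by
              rw [hMv, Fin.prod_univ_succ]
              show B * (‖v 0‖ * ∏ i : Fin s, ‖v i.succ‖) = B * ‖v 0‖ * ∏ i : Fin s, ‖v i.succ‖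
              ring
      have hmv := norm_image_sub_le_of_norm_deriv_le_segment' (f := fun t' : ℝ => g σ (u + t' • v 0))
        (fun t _ => (hline σ hσU t).hasDerivWithinAt) hderivbd (hseq k) ⟨(hpos k).le, le_rfl⟩
      simp only [zero_smul, add_zero, sub_zero] at hmv
      simp only [hq]
      rw [norm_mul, norm_inv, Complex.norm_real, Real.norm_eq_abs, abs_of_pos (hpos k)]
      calc (hseq k)⁻¹ * ‖g σ (u + hseq k • v 0) - g σ u‖ ≤ (hseq k)⁻¹ * (Mv * hseq k) :=
            mul_le_mul_of_nonneg_left hmv (inv_pos.mpr (hpos k)).le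
        _ = Mv := by rw [mul_comm Mv, ← mul_assoc, inv_mul_cancel₀ (hpos k).ne', one_mul]
    exact differentiableOn_of_tendsto_locally_bounded hU (Eventually.of_forall hqhol) hqbd hqlim

end Summit.HubbardSuperconductivity.HubbardSuperconductivity.Theorems.ComplexGFF

end
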